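import Summits.AtomisticToContinuum.HydrodynamicLimit.Theorems.AntiMazurCoboundariesKineticWindowGronwallFamilyGlue
import Summits.AtomisticToContinuum.HydrodynamicLimit.Theorems.AntiMazurCoboundariesKineticWindowGronwallTwoProfileTransfer
import Summits.AtomisticToContinuum.HydrodynamicLimit.Theorems.AntiMazurCoboundariesKineticWindowGronwallWindowEnergyMoment
import Summits.AtomisticToContinuum.HydrodynamicLimit.Theorems.AntiMazurCoboundariesKineticWindowGronwallTailReorth
import HarnessLib

/-!
# The family glue, unconditional (registered stub `stub_familyGlue` of line `rare-band-ladder-dock` v7, crux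
# `KineticWindowGronwall`, stmt-AtomisticToContinuum-9282)

Crux `Summit.AtomisticToContinuum.HydrodynamicLimit.Theses.AntiMazurCoboundaries.KineticWindowGronwall`. The three registered helper stubs of
the glue are LANDED — `KineticWindowGronwallTwoProfileTransfer.stub_twoProfileTransfer` (p148641: static order-2 Rényi change of measure between
local Gibbs laws with nearby profiles), `KineticWindowGronwallWindowEnergyMoment.stub_windowEnergyMoment` (p146839: window exponential moment of
`λΣ(1+‖vᵢ‖²)` by energy conservation + fibre Gaussians), `KineticWindowGronwallTailReorth.stub_tailReorth` (p147043: the re-orthogonalised radial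
tail cut-off) — and so is the glue modulo them (`familyGlue_of`, p148139). Their statements are byte-identical copies of this namespace's (same
terms), so `stub_familyGlue : FamilyGlue` — `LocalQuadraticWindowLDBounds → LocalQuadraticWindowLDFamily`: thresholds pointwise in the local Gibbs
profile upgrade to thresholds uniform along jointly continuous families — holds outright.
-/

noncomputable section

namespace Summit.AtomisticToContinuum.HydrodynamicLimit.Theorems.KineticWindowGronwallFamilyGlue

/-- **STUB `stub_familyGlue` (line rare-band-ladder-dock v7, crux stmt-AtomisticToContinuum-9282): the family glue holds** —
`LocalQuadraticWindowLDBounds → LocalQuadraticWindowLDFamily` (`familyGlue_of` fed by the three landed helper stubs). [cite: OllaVaradhanYau1993, §3] -/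
theorem stub_familyGlue : FamilyGlue :=
  familyGlue_of KineticWindowGronwallTwoProfileTransfer.stub_twoProfileTransfer
    KineticWindowGronwallWindowEnergyMoment.stub_windowEnergyMoment KineticWindowGronwallTailReorth.stub_tailReorth

/-- The v6 dockable wall `LocalTransferE` (family-wise; landed `Theorems.KineticWindowGronwallEndStateBoard`) from the v7 profile-wise one
`LocalTransferEB := EquilibriumFastWindowLD → LocalQuadraticWindowLDBounds` (landed `Theorems.KineticWindowGronwallPlusNode`) — by the glue. -/
theorem localTransferE_of_localTransferEB
    (h : Summit.AtomisticToContinuum.HydrodynamicLimit.Theses.TwoClocks.EquilibriumFastWindowLD → LocalQuadraticWindowLDBounds) :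
    Summit.AtomisticToContinuum.HydrodynamicLimit.Theses.TwoClocks.EquilibriumFastWindowLD → LocalQuadraticWindowLDFamily :=
  fun h₀ => stub_familyGlue (h h₀)

end Summit.AtomisticToContinuum.HydrodynamicLimit.Theorems.KineticWindowGronwallFamilyGlue

end
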